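import Literature.Computability.AlgebraicComplexity.Hyperdeterminant
import HarnessLib

/-!
# Rearrangements of a word: the orbit–stabiliser count `#{ε ∈ S_ℓ : u ∘ ε = J} · #{I : x_I = x_J} = ℓ!`
# (normalisation of symmetric tensors, BIP 2019 §3(a)) — theorem-only

P. Bürgisser, C. Ikenmeyer, G. Panova, *No occurrence obstructions in geometric complexity
theory*, J. AMS **32** (2019) = arXiv:1604.06431 [BurgisserIkenmeyerPanovaJAMS2019], §3(a): forms of
degree `ℓ` on `V^*` are symmetric tensors, a monomial `x_J = x_{J(1)} ⋯ x_{J(ℓ)}` corresponding to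
the symmetrisation of `e_{J(1)} ⊗ ⋯ ⊗ e_{J(ℓ)}`; the normalising factor between the two is the
number `#{I : x_I = x_J}` of words with the content of `J` (the multinomial coefficient; the tree's
`arrOf`, `Hyperdeterminant.lean`), and `S_ℓ` acts on the words of a given content transitively with
stabilisers of the complementary size. THEOREM-ONLY file (no definitions, no named facts):

* `card_filter_comp_perm_eq_of_wordExp_eq` — all fibres `{ε : u ∘ ε = I}` over words `I` of the
  content of `u` have the size of the stabiliser of `u`;
* `card_filter_comp_perm_mul_card_filter_wordExp` — **`#{ε ∈ S_ℓ : u ∘ ε = J} · #{I : x_I = x_J} = ℓ!`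
  if `u` and `J` have the same content, and `#{ε : u ∘ ε = J} = 0` otherwise** (orbit–stabiliser);
* `card_filter_comp_perm_eq_div` — the same in a field of characteristic zero:
  `#{ε : u ∘ ε = J} = [x_u = x_J] · ℓ! / #{I : x_I = x_J}`.

(Used to read the polarisation of a product of normalised coordinate functions `symArrayPoly` as a
count over the wreath product `S_d ≀ S_D`, BI 2017 Rem. 3.13 / eq. (3.4).)

Honest framing: elementary counting for the cell `val-lit`; VP ≠ VNP is NOT proved and nothing here
bears on it.

## References

* [BurgisserIkenmeyerPanovaJAMS2019] P. Bürgisser, C. Ikenmeyer, G. Panova, J. AMS 32 (2019) =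
  arXiv:1604.06431, §3(a).
-/

namespace Literature.Computability.AlgebraicComplexity

variable {σ : Type*} [Fintype σ] [DecidableEq σ] {ℓ : ℕ}

omit [Fintype σ] in
/-- **All fibres of `ε ↦ u ∘ ε` over the words of the content of `u` have the size of the stabiliser
of `u`**: if `x_I = x_u` then `#{ε ∈ S_ℓ : u ∘ ε = I} = #{ε ∈ S_ℓ : u ∘ ε = u}` (translate by one
`π` with `u ∘ π = I`). [cite: BurgisserIkenmeyerPanovaJAMS2019, §3(a)] -/
theorem card_filter_comp_perm_eq_of_wordExp_eq {u I : Fin ℓ → σ} (h : wordExp I = wordExp u) :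
    ((Finset.univ : Finset (Equiv.Perm (Fin ℓ))).filter fun ε : Equiv.Perm (Fin ℓ) => u ∘ ⇑ε = I).card =
      ((Finset.univ : Finset (Equiv.Perm (Fin ℓ))).filter fun ε : Equiv.Perm (Fin ℓ) => u ∘ ⇑ε = u).card := by
  classical
  obtain ⟨π, hπ⟩ := exists_comp_perm_eq_of_wordExp_eq h.symm
  -- `{ε : u ∘ ε = I} = {ε : u ∘ ε = u} · π`
  have himage : ((Finset.univ : Finset (Equiv.Perm (Fin ℓ))).filter fun ε : Equiv.Perm (Fin ℓ) => u ∘ ⇑ε = I) =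
      (((Finset.univ : Finset (Equiv.Perm (Fin ℓ))).filter fun ε : Equiv.Perm (Fin ℓ) => u ∘ ⇑ε = u).image
        fun ε => ε * π) := by
    ext ε'
    simp only [Finset.mem_filter, Finset.mem_univ, true_and, Finset.mem_image]
    constructor
    · intro hε'
      refine ⟨ε' * π⁻¹, ?_, by rw [inv_mul_cancel_right]⟩
      rw [Equiv.Perm.coe_mul, ← Function.comp_assoc, hε', ← hπ, Function.comp_assoc,
        ← Equiv.Perm.coe_mul, mul_inv_cancel, Equiv.Perm.coe_one, Function.comp_id]
    · rintro ⟨ε, hε, rfl⟩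
      rw [Equiv.Perm.coe_mul, ← Function.comp_assoc, hε, hπ]
  rw [himage, Finset.card_image_of_injective _ (mul_left_injective π)]

/-- **Orbit–stabiliser for rearrangements of a word**: `#{ε ∈ S_ℓ : u ∘ ε = J} · #{I : x_I = x_J}`
is `ℓ! = |S_ℓ|` if `u` and `J` have the same content (`S_ℓ` is the disjoint union, over the
`#{I : x_I = x_u}` words `I` of that content, of the fibres `{ε : u ∘ ε = I}`, all of the size of the
stabiliser), and `0` otherwise (no `ε` at all). [cite: BurgisserIkenmeyerPanovaJAMS2019, §3(a)] -/
theorem card_filter_comp_perm_mul_card_filter_wordExp (u J : Fin ℓ → σ) :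
    ((Finset.univ : Finset (Equiv.Perm (Fin ℓ))).filter fun ε : Equiv.Perm (Fin ℓ) => u ∘ ⇑ε = J).card *
        ((Finset.univ : Finset (Fin ℓ → σ)).filter fun I => wordExp I = wordExp J).card =
      if wordExp u = wordExp J then Nat.factorial ℓ else 0 := by
  classical
  by_cases h : wordExp u = wordExp J
  · rw [if_pos h]
    set T : Finset (Fin ℓ → σ) := Finset.univ.filter fun I => wordExp I = wordExp u with hT
    set St : Finset (Equiv.Perm (Fin ℓ)) := Finset.univ.filter fun ε : Equiv.Perm (Fin ℓ) => u ∘ ⇑ε = u with hSt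
    -- `|S_ℓ| = ∑_{I ∈ T} #{ε : u ∘ ε = I} = |T| · |St|`
    have hfib := Finset.card_eq_sum_card_fiberwise (s := (Finset.univ : Finset (Equiv.Perm (Fin ℓ))))
      (t := T) (f := fun ε : Equiv.Perm (Fin ℓ) => u ∘ ⇑ε) fun ε _ =>
        Finset.mem_filter.mpr ⟨Finset.mem_univ _, wordExp_comp_perm u ε⟩
    have hconst : ∀ I ∈ T, ((Finset.univ : Finset (Equiv.Perm (Fin ℓ))).filter
        fun ε : Equiv.Perm (Fin ℓ) => u ∘ ⇑ε = I).card = St.card := fun I hI =>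
      card_filter_comp_perm_eq_of_wordExp_eq (Finset.mem_filter.mp hI).2
    rw [Finset.sum_congr rfl hconst, Finset.sum_const, smul_eq_mul, Finset.card_univ,
      Fintype.card_perm, Fintype.card_fin] at hfib
    -- our two factors are `|St|` and `|T|`
    have h1 : ((Finset.univ : Finset (Equiv.Perm (Fin ℓ))).filter fun ε : Equiv.Perm (Fin ℓ) => u ∘ ⇑ε = J).card =
        St.card := card_filter_comp_perm_eq_of_wordExp_eq h.symm
    have h2 : ((Finset.univ : Finset (Fin ℓ → σ)).filter fun I => wordExp I = wordExp J) = T := by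
      rw [hT, h]
    rw [h1, h2, hfib, Nat.mul_comm]
  · rw [if_neg h, Finset.card_eq_zero.mpr, zero_mul]
    refine Finset.filter_eq_empty_iff.mpr fun ε _ hε => h ?_
    rw [← hε, wordExp_comp_perm]

/-- The orbit–stabiliser count in a field of characteristic zero:
`#{ε ∈ S_ℓ : u ∘ ε = J} = [x_u = x_J] · ℓ! / #{I : x_I = x_J}`. [cite: BurgisserIkenmeyerPanovaJAMS2019, §3(a)] -/
theorem card_filter_comp_perm_eq_div (k : Type*) [Field k] [CharZero k] (u J : Fin ℓ → σ) :
    ((((Finset.univ : Finset (Equiv.Perm (Fin ℓ))).filter fun ε : Equiv.Perm (Fin ℓ) => u ∘ ⇑ε = J).card : ℕ) : k) =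
      if wordExp u = wordExp J then
        (Nat.factorial ℓ : k) /
          ((Finset.univ : Finset (Fin ℓ → σ)).filter fun I => wordExp I = wordExp J).card
      else 0 := by
  classical
  have hN : ((((Finset.univ : Finset (Fin ℓ → σ)).filter fun I => wordExp I = wordExp J).card : ℕ) :
      k) ≠ 0 := Nat.cast_ne_zero.mpr (card_filter_wordExp_pos J).ne'
  have h := congrArg (fun n : ℕ => (n : k)) (card_filter_comp_perm_mul_card_filter_wordExp u J)
  simp only [Nat.cast_mul, Nat.cast_ite, Nat.cast_zero] at h
  split_ifs at h with hc
  · rw [if_pos hc, eq_div_iff hN, h]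
  · rw [if_neg hc]
    rcases mul_eq_zero.mp h with h0 | h0
    · exact h0
    · exact absurd h0 hN

end Literature.Computability.AlgebraicComplexity
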